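import Summits.BirchSwinnertonDyer.Rank1Residual.O6.X3KatoMemberBound
import Literature.NumberTheory.EllipticCurves.Kato2004.StableLatticeHomothetyProofs
import HarnessLib

/-!
# O6 / X4 ∧ ¬(12.5.2), rank 0: T-X4E — CONGRUENCE TRANSPORT of `μ = 0` at an additive prime and Kato UNIT ANCHORS (typed targets)
(cell `b2b-bsdres`, lane CLASS-CLOSURE, class O6 §3.4 ∩ X4 (the Elkies corner of RESIDUAL-MAP §D add. 5); planner o6-r1 GEN 22 —
 memo `HOME/b2b-bsdres-o6-r1/gen22/O6-GEN22.md` (sha16 `f5929fb650004bca`) §2 (T-μ)/(A⋆)/T-X4E, §3 census pilot C-X4E-0; typed sketch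
 `gen22/lean/O6X3KatoMember.lean` (sha16 `3b84133d0e97abae`) §X4E, `lean check` rc 0 by the planner; INBOX 2026-08-22T10:28Z l.11283
 ASK "cc-typer → … then the GEN 22 APPEND delta (or sibling `O6/X4CongruenceAnchor.lean`)"; typer of record cc-typer-5 GEN 15; 0 Literature
 facts.  PLACEMENT: the GEN 22 sketch's §Glue (T-X3K ⟹ T-X3K♯) is ALREADY IN THE TREE as `O6/X3KatoMemberBound.lean` §3 (p325325,
 `x3PotGoodRankZeroUpperOfSmallClassTorsion_of_katoMember`, `exists_shaAn_le_add_torsion_of_katoCurrency`) + `O6/X3KatoMemberBoundReadings.lean`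
 (p325946, `X3WildRankZero.missingUpperBoundAt_of_katoMember`, `…bsdp_of_isIsogenous_of_unit_member`) — not re-landed; this file = §X4E only
 (decl bodies byte-identical to the sketch; the one consumer call re-pointed from the sketch's `exists_shaAn_le_add_torsion_of_katoShape` to the
 tree's `exists_shaAn_le_add_torsion_of_katoCurrency`, same statement modulo the displayed `Finite W.sha`); §X4E-t1 (first-layer anchors,
 T-X4E-t1) is the sibling `O6/X4CongruenceFirstLayerAnchor.lean` (`lint.size`).)

HONEST FRAMING (cell `b2b-bsdres`, run/shared/lean/b2b/bsd-rank1-residual/, verbatim in every file): the goal of the cell is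
to DELETE the COMBINATION-SHAPED residual classes of the Birch–Swinnerton-Dyer formula for ALL analytic-rank `≤ 1` elliptic
curves over `ℚ` — "full BSD formula for every rank `≤ 1` curve in class `C`" assembled STRICTLY from published theorems — so that
the rank-`≤ 1` remainder becomes exactly the CONSTRUCTION-SHAPED classes, which are TYPED (missing-input `Prop`s), NOT attempted.
This is not "finishing BSD". Lane CLASS-CLOSURE: research routes; census output is EVIDENCE / conjecture items, never a Literature
fact; no main conjecture inside any certificate; nothing is booked; no mark of `RESIDUAL-MAP.md` moves; O6 and X4 stay OPEN.

WHAT THE PLANNER FOUND (sketch §X4E section text, verbatim): — congruence transport of `μ = 0` at an additive prime (o6-r1 GEN 22)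

The export (Kμ-K) `X4UpperOfFineMuZero` needs `FineMuZero W p` (`μ = 0` for Kato's `𝐇²(T_pW)⁰`, i.e.
Coates–Sujatha Conjecture A for `W` over the cyclotomic `ℤ_p`-extension, up to finitely generated `ℤ_p`
local terms — memo AUD-4) on the X4 rows WITHOUT Kato's (12.5.2); at `p = 3` on O6 ∧ r0 these are the
`364` tower-NO pairs of RESIDUAL-MAP §D add. 5 (`344` non-surjective mod `3` + `20` of Elkies type:
surjective mod `3`, not mod `9`, `j ∈ {4374, −44789760, 15786448344}`, `v₃(N) = 5`).
Two displayed statements turn `FineMuZero` into an ANCHOR problem: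
* **(T-μ)** `FineMuZero` is a property of the Galois module `E[p]` alone — IN PRINT for the fine Selmer
  reading: M. F. Lim, R. Sujatha, *Fine Selmer groups of congruent Galois representations*, J. Number
  Theory 187 (2018) 66–91, §3, Prop. 3.2 (arXiv:1603.08640v3 numbering, lit-kato GEN 36 AUD-17; the held de-TeXed text labels
  it "(fg cong)"): `A[π] ≅ B[π]` as `G_S(F)`-modules ⇒
  (Conjecture A for `Y_S(A/F^cyc)` ⇔ Conjecture A for `Y_S(B/F^cyc)`), via
  `Conj A ⇔ H²(G_S(F^cyc), A[π]) = 0` (arXiv:1603.08640 §3; held text `paper:arxiv-1603.08640`, statement page-checked by the typer); the ordinary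
  Selmer precedent is Greenberg–Vatsal, Invent. Math. 142 (2000).
* **(A⋆)** a curve `E′` with Kato's (12.5.2) at `p`, additive potentially good reduction at `p`, a
  `p`-adic UNIT `L(E′,1)/Ω_{E′}` and `E′(ℚ_p)[p] = 0` has `𝐇²(T_pE′)⁰` FINITE (so `FineMuZero E′ p`):
  Kato Thm. 12.4 (3) (p. 221: `E′[p]` irreducible, `p ≠ 2` ⇒ `𝐇¹(T′)` free of rank one), the tree's
  A161″ bookkeeping `ord_p #Ш′[p^∞] + Σ_ℓ v_p(c_ℓ′) + m′ = ord_p(L(E′,1)/Ω′)` with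
  `p^{m′} = [H¹(ℤ[1/p],T′) : z₀]/#H²(ℤ[1/p],T′)` (docstring of
  `Kato2004.rankZero_padicValNat_sha_add_padicValNat_tamagawa_le_…`, audited KATO2004-TYPING §29) ⇒
  `m′ = 0`, Artin–Verdier on `Spec ℤ[1/p]` ⇒ `#H²(ℤ[1/p], j_*T′) = #E′(ℚ_p)[p^∞] = 1`, hence `z₀`
  generates `H¹(ℤ[1/p],T′) ≅ ℤ_p`; derived descent `0 → 𝐇¹(T′)⁰_Γ → H¹(ℤ[1/p],T′) → 𝐇²(T′)⁰^Γ → 0`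
  and Nakayama ⇒ `𝐇¹(T′)⁰ = Λ₀·z`; Thm. 12.5 (4) (p. 222, `f′` potentially good at `p` so (12.5.1) is
  void) ⇒ `𝐇²(T′)⁰_𝔮 = 0` at every height-one `𝔮` ⇒ pseudo-null ⇒ finite.  THEOREM-CANDIDATE
  (audit items AUD-14: the `j_*`-Artin–Verdier count — PASS, lit-kato GEN 36; AUD-15/16 settled by the page read of 12.4).
The composite T-X4E closes the Elkies corner GIVEN one anchor per target; the census pilot C-X4E-0
(`gen22/x4e/`) finds certified-congruent tower-surjective unit anchors with `N′ ≤ 5·10⁵` for `19` of the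
`20` O6 ∧ r0 Elkies pairs (none in range for `388800ha1`).  The `344` N(C) pairs admit NO Kato anchor
(`E′[3] ≅ E[3]` forces the same mod-`3` image, so (12.5.2) fails for `E′` too) — question Q-NC (CM
anchors) of the memo.  Everything below is a `def … : Prop` or a proved implication; nothing asserted.

WHAT IS TYPED (bodies verbatim): `ModPCongruent W W' p` (the tree's inline idiom `e : W.geomTorsion p ≃+ W'.geomTorsion p` +
`Γ_ℚ`-equivariance, named; no new object); **(T-μ)** `@[conjecture] FineMuZeroCongruenceInvariant FineMuZero` (IN PRINT for the fine
Selmer reading — Lim–Sujatha, J. Number Theory 187 (2018) §3: "Suppose that there is an isomorphism `A[π] ≅ B[π]` of `G_S(F)`-modules.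
Then Conjecture A holds for `Y_S(A/F^cyc)` if and only if Conjecture A holds for `Y_S(B/F^cyc)`" — page-checked by the typer on the held
text arXiv:1603.08640; typed `@[conjecture]` over the INTERFACE `FineMuZero` because the interface has no tree object, so nothing is
citable as a fact yet; PRINTED-CANDIDATE per o6-r1 — registry placement is the lit seat's call, the T-X3K precedent; 0 Literature facts
by this lane); **(A⋆)** `@[conjecture] FineMuZeroOfUnitAnchor FineMuZero` (THEOREM-CANDIDATE; lit-kato GEN 36 AUD-14 PASS — every
antecedent printed; EVIDENCE-labelled `@[conjecture]` until a TREE PROOF);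
`IsKatoUnitAnchor`; **T-X4E** `@[conjecture] X4UpperOfCongruentUnitAnchor` = (Kμ-K) ∘ (T-μ) ∘ (A⋆) with the interface eliminated,
PROVED composition `x4UpperOfCongruentUnitAnchor_of`; readings `X4WildRankZero.missingUpperBoundAt_of_congruentUnitAnchor(')`,
`…missingPPartAt_of_congruentUnitAnchor_of_unit`, `hasIrreducibleModPGaloisRep_of_congruentAnchor` (PROVED).
INTENDED BINDING of `FineMuZero W p` (as in `X4UpperOfFineMuZero`): "`μ(𝐇²(T_pW)⁰) = 0`, i.e. the Pontryagin dual of the fine Selmer group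
of `W[p^∞]` over `ℚ(μ_{p^∞})` is finitely generated over `ℤ_p` (Coates–Sujatha Conjecture A) up to finitely generated local terms" —
no tree vocabulary; `fun _ _ => True` is NOT a legitimate binding.  DEDUP (`lean search`): `ModPCongruent`, `FineMuZeroCongruenceInvariant`,
`FineMuZeroOfUnitAnchor`, `IsKatoUnitAnchor`, `X4UpperOfCongruentUnitAnchor`, `X4CongruenceAnchor` — no match (`O5.IsCongruentModThree` is
the TRACE congruence at `3`, a different notion); reused by name: `X4UpperOfFineMuZero`, `exists_shaAn_le_add_torsion_of_katoCurrency`,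
`Kato2004.ImageContainsSL2`, `Kato2004.hasIrreducibleModPGaloisRep_of_imageContainsSL2`, `Mazur1978.hasIrreducibleModPGaloisRep_of_addEquiv`,
`torsionPoints`, `geomTorsion`, `ClassO6`, `MissingUpperBoundAt`, `MissingPPartAt`.  Bib: the sketch's keys `LimSujatha2018`
/ `CoatesSujatha2005` / `MilneADT2006` are registered as `LimSujatha2018` (doi 10.1016/j.jnt.2017.10.018) / `CoatesSujatha2005` /
`MilneADT2006`.

EVIDENCE of record (o6-r1 GEN 22, memo §3; instrumentation only; census-lead intake of `gen22/x4e/anchor_cert.tsv` requested, VALID word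
pending; census-lead G-32 intake requests l.2853): census pilot C-X4E-0 — 18 of the 20 O6 ∧ r0 Elkies pairs (surjective mod 3, not mod 9; `j ∈ {4374, −44789760, 15786448344}`,
`v₃(N) = 5`) have ≥ 2 CERTIFIED `E[3]`-congruent Kato unit anchors with `N′ ≤ 5·10⁵` (80 certified (target, anchor) pairs; congruence by
two independent rigorous certificates, kit j158549 `x4e_cert3.gp`, negative/positive control j158590 8/8 + 3/3; local 3-adic data j158376);
the 2 remaining r0 pairs `388800ha1`, `388800ij1` have `E(ℚ₃)[3] = ℤ/3` (type IV*, `c₃ = 3`), a congruence invariant, so NO unit anchor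
exists for them (sub-corner R-X4E-t1, sibling file); the 344 N(C) (non-surjective mod 3) X4 r0 pairs admit no Kato anchor (same mod-3
image) — memo Q-NC.  PRESEARCH (typer, corpus + galaxy, 2026-08-22): (T-μ) → [corpus:paper:arxiv-1603.08640 §3] (in print, fine Selmer
reading); (A⋆) / T-X4E → none in print beyond the cited Kato pages (nearest: Greenberg–Vatsal 2000 / Emerton–Pollack–Weston 2006 for the
ORDINARY Selmer `μ`; tree `GreenbergVatsal2000.thm14_mainConjecture_transfer_of_torsionIso`).
References: K. Kato, Astérisque 295 (2004) Thm. 12.4 (3), Thm. 12.5 (4), (12.5.2), Thm. 12.6, Thm. 14.5 (3), Lemma 14.7, Prop. 14.16 (2)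
[Kato2004Asterisque]; M. F. Lim, R. Sujatha, J. Number Theory 187 (2018) 66–91, §3 [LimSujatha2018]; J. Coates, R. Sujatha, Math. Ann.
331 (2005) Conj. A [CoatesSujatha2005]; R. Greenberg, V. Vatsal, Invent. Math. 142 (2000) [GreenbergVatsal2000]; J. S. Milne, ADT
Thm. II.3.1 / Cor. II.3.3 [MilneADT2006]; R. L. Miller, LMS J. Comput. Math. 14 (2011) §1, Def. 1.1 [Miller2011LMS]; H. Darmon, CBMS 101
(2004) Thm. 3.22 [Darmon2004]; B. Mazur, Invent. Math. 44 (1978) [Mazur1978].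
-/

set_option autoImplicit false

noncomputable section

open scoped Classical

open WeierstrassCurve Literature.NumberTheory.EllipticCurves
  Literature.NumberTheory.EllipticCurves.Rank1Residual
  Literature.NumberTheory.EllipticCurves.Rank1Residual.Typed
  Summit.BirchSwinnertonDyer.Rank1Residual.Additive

namespace Summit.BirchSwinnertonDyer.Rank1Residual.O6

/-! ## §X4E — the typed statements (o6-r1 GEN 22 sketch §X4E; bodies verbatim) -/

section X4E

variable (FineMuZero : ∀ (W : WeierstrassCurve ℚ) [W.IsElliptic], ℕ → Prop)

/-- **Mod-`p` congruence** of two elliptic curves over `ℚ`: a `Γ_ℚ`-equivariant additive isomorphism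
`E[p] ≃ E′[p]` of the geometric `p`-torsion (tree objects: `geomTorsion`, with the `Γ_ℚ`-action of
`GaloisAction.lean`) — an ABBREVIATION of the tree's inline idiom for `E₁[p] ≅ E₂[p]`
(`GreenbergVatsal2000.thm14_mainConjecture_transfer_of_torsionIso`,
`EmertonPollackWeston2006.cor514_transfer_of_goodOrdinary`, `Mazur1978.hasIrreducibleModPGaloisRep_of_addEquiv`);
no new object.  Serre (1972), §4; Silverman, *AEC*, III.§7. [folklore] -/
def ModPCongruent (W W' : WeierstrassCurve ℚ) (p : ℕ) : Prop :=
  ∃ e : W.geomTorsion (p : ℤ) ≃+ W'.geomTorsion (p : ℤ),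
    ∀ (σ : Field.absoluteGaloisGroup ℚ) (P : W.geomTorsion (p : ℤ)), e (σ • P) = σ • e P

/-- **(T-μ) — `μ = 0` of the fine part is an invariant of the mod-`p` Galois module** (o6-r1 GEN 22,
interface `FineMuZero`).  IN PRINT for the fine Selmer group over the cyclotomic `ℤ_p`-extension:
Lim–Sujatha, J. Number Theory 187 (2018), §3, Prop. 3.2 (arXiv v3 numbering; "(fg cong)" in the held text) (with Conjecture A ⇔
`𝐇²_S(F^cyc/F, T)` finitely generated over `ℤ_p`, Coates–Sujatha 2005, and ⇔ `H²(G_S(F^cyc), E[p]) = 0`).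
Typed over the interface; becomes a citable fact once `FineMuZero` is a tree object.  Nothing asserted.
TYPER (cc-typer-5 GEN 15): PRINTED-CANDIDATE — lit-kato GEN 36 AUD-17: "Proposition 3.2. Suppose that there is an isomorphism
A[π] ≅ B[π] of G_S(F)-modules. Then Conjecture A holds for Y_S(A/F^cyc) if and only if Conjecture A holds for Y_S(B/F^cyc)"
(arXiv:1603.08640v3 §3, PDF p. 9; VoR numbering pending acq-10137); typed `@[conjecture]` over the interface only because
`FineMuZero` has no tree object; registry placement is the lit seat's call (0 Literature facts by this lane).
[cite: LimSujatha2018, Prop. 3.2 (arXiv:1603.08640v3 §3, PDF p. 9; J. Number Theory 187 (2018) 66–91, VoR numbering pending acq-10137)]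
[cite: CoatesSujatha2005, Conjecture A and §3] [cite: GreenbergVatsal2000, Introduction] -/
@[conjecture] def FineMuZeroCongruenceInvariant : Prop :=
  ∀ (W : WeierstrassCurve ℚ) [W.IsElliptic] (W' : WeierstrassCurve ℚ) [W'.IsElliptic]
    (p : ℕ) [Fact p.Prime], ModPCongruent W W' p → FineMuZero W p → FineMuZero W' p

/-- **(A⋆) — Kato anchors** (o6-r1 GEN 22; THEOREM-CANDIDATE — lit-kato GEN 36 AUD-14 PASS; `@[conjecture]` until a tree proof): a globally minimal `W′`
with additive potentially good reduction at an odd `p`, Kato's (12.5.2), no `ℚ_p`-rational `p`-torsion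
and a `p`-adic UNIT `L(W′,1)/Ω(W′)` has `FineMuZero W′ p` (indeed `𝐇²(T_pW′)⁰` finite): Kato Thm.
12.4 (3) + 12.5 (4) + the tree's A161″ index bookkeeping (`m′ = 0`) + `#H²(ℤ[1/p], j_*T′) =
#E′(ℚ_p)[p^∞]` (Artin–Verdier) + derived descent + Nakayama (section docstring).  Nothing asserted.
[cite: Kato2004Asterisque, Thm. 12.4 (3) (p. 221), Thm. 12.5 (4) and (12.5.2) (p. 222), Thm. 14.5 (3) (p. 236), Prop. 14.16 (2) (p. 244)]
[cite: MilneADT2006, Thm. II.3.1 (Artin–Verdier) and Cor. II.3.3] -/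
@[conjecture] def FineMuZeroOfUnitAnchor : Prop :=
  ∀ (W' : WeierstrassCurve ℚ) [W'.IsElliptic] [W'.IsGloballyMinimal] (p : ℕ) [Fact p.Prime],
    p ≠ 2 →
    ¬ W'.HasGoodReductionAtPrime p → ¬ W'.HasMultiplicativeReductionAtPrime p →
    0 ≤ padicValRat p W'.j →
    Kato2004.ImageContainsSL2 W' p →
    torsionPoints W' ℚ_[p] (p : ℤ) = ⊥ →
    (∃ q' : ℚ, W'.entireLFunction 1 / (W'.realPeriodRat : ℂ) = (q' : ℂ) ∧ q' ≠ 0 ∧ padicValRat p q' = 0) →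
    FineMuZero W' p

/-- The ANCHOR predicate of T-X4E for a pair `(W′, p)`: the hypotheses of (A⋆), bundled (additive
potentially good at `p`, (12.5.2), `W′(ℚ_p)[p] = 0`, unit `L(W′,1)/Ω(W′)`).  Bookkeeping. [folklore] -/
def IsKatoUnitAnchor (W' : WeierstrassCurve ℚ) [W'.IsElliptic] (p : ℕ) [Fact p.Prime] : Prop :=
  ¬ W'.HasGoodReductionAtPrime p ∧ ¬ W'.HasMultiplicativeReductionAtPrime p ∧
    0 ≤ padicValRat p W'.j ∧ Kato2004.ImageContainsSL2 W' p ∧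
    torsionPoints W' ℚ_[p] (p : ℤ) = ⊥ ∧
    ∃ q' : ℚ, W'.entireLFunction 1 / (W'.realPeriodRat : ℂ) = (q' : ℂ) ∧ q' ≠ 0 ∧ padicValRat p q' = 0

/-- **T-X4E — the Elkies-corner target (o6-r1 GEN 22): Kato's A161″ conclusion on an additive
potentially good pair `(W, p)` with `W[p]` IRREDUCIBLE, GIVEN a Kato unit anchor `W′` with
`W′[p] ≅ W[p]`** — i.e. (Kμ-K) ∘ (T-μ) ∘ (A⋆) with the interface `FineMuZero` eliminated (proved
composition `x4UpperOfCongruentUnitAnchor_of` below).  Census test = C-X4E-0/1 (anchor existence per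
`E[3]`-class; `gen22/x4e/anchor_sieve.json`, kit j158376).  EVIDENCE-labelled conjecture declaration;
nothing asserted. [cite: Kato2004Asterisque, Thm. 12.4 (3), 12.5 (3)(4), 12.6 (pp. 221–222), cf. Lemma 14.7 (p. 238), Thm. 14.5 (3) (p. 236)]
[evidence: o6-r1 GEN 22 census pilot C-X4E-0 (gen22/x4e/: anchor_sieve.{py,json}, x4e_cert3.gp kit j158549, control x4e_cert_control.gp j158590 8/8 + 3/3, tors3loc j158376; anchor_cert.tsv 87 rows, anchor_cert_summary.json; memo gen22/O6-GEN22.md f5929fb650004bca §3): 18 / 20 O6 ∧ r0 Elkies pairs have ≥ 2 CERTIFIED E[3]-congruent Kato unit anchors with N′ ≤ 5·10⁵ (80 certified (target, anchor) pairs); 388800ha1 / 388800ij1 have E(ℚ₃)[3] = ℤ/3 ⇒ no unit anchor (R-X4E-t1); lit-kato GEN 36 AUDIT (INBOX 2026-08-22T10:54Z, `HOME/b2b-bsdres-lit-kato/gen36/KATO-PAGE-READ-gen36.md` 2175bd9283491ed4): AUD-14 PASS (Kato's (14.9.1) p. 239 Poitou–Tate for ramified T, local terms only at p; the j_*-bookkeeping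 at bad primes = Lemma T's ∏c_ℓ^{(p)}), AUD-17 ANSWERED (Prop. 3.2 of arXiv:1603.08640v3, PDF p. 9; VoR numbering pending acq-10137), AUD-19 PASS (descent = Kato (14.14.1)–(14.14.2) p. 243 + 13.8 p. 228 twisted; length lemma = Kato Lemma 14.15 pp. 243–244; Cor. 14.3 p. 235 hypotheses exact); nits N-4 (multiplicative bad ℓ of the anchor also fine) / N-5 / N-6 and simplifications S-1 / S-2 / C-2 are the memo's to fold]
[cite: LimSujatha2018, Prop. 3.2 (arXiv:1603.08640v3 §3)] -/
@[conjecture] def X4UpperOfCongruentUnitAnchor : Prop :=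
  ∀ (W : WeierstrassCurve ℚ) [W.IsElliptic] [W.IsGloballyMinimal] (p : ℕ) [Fact p.Prime],
    p ≠ 2 →
    ¬ W.HasGoodReductionAtPrime p → ¬ W.HasMultiplicativeReductionAtPrime p →
    0 ≤ padicValRat p W.j →
    W.HasIrreducibleModPGaloisRep p →
    (∃ (W' : WeierstrassCurve ℚ) (_ : W'.IsElliptic) (_ : W'.IsGloballyMinimal),
        ModPCongruent W' W p ∧ IsKatoUnitAnchor W' p) →
    W.entireLFunction 1 ≠ 0 → Finite W.sha →
    ∃ q : ℚ, W.entireLFunction 1 / (W.realPeriodRat : ℂ) = (q : ℂ) ∧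
      (padicValNat p (Nat.card (AddCommGroup.primaryComponent W.sha p)) : ℤ) +
          padicValNat p W.tamagawaProduct ≤ padicValRat p q

/-- **T-X4E = (Kμ-K) ∘ (T-μ) ∘ (A⋆)** for ANY reading of the interface `FineMuZero` (kernel composition;
the three displayed hypotheses are the conjecture declarations above). [folklore] -/
theorem x4UpperOfCongruentUnitAnchor_of (hK : X4UpperOfFineMuZero FineMuZero)
    (hT : FineMuZeroCongruenceInvariant FineMuZero) (hA : FineMuZeroOfUnitAnchor FineMuZero) :
    X4UpperOfCongruentUnitAnchor := by
  intro W _ _ p _ hp hg hm hj hirr hanchor hL hfin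
  obtain ⟨W', hW'e, hW'm, hcong, hg', hm', hj', himg', ht', hu'⟩ := hanchor
  exact hK W p hp hg hm hj hirr (hT W' W p hcong (hA W' p hp hg' hm' hj' himg' ht' hu')) hL hfin

/-- **T-X4E in the cell's currency on O6 ∧ X4 ∧ r0** (o6-r1 GEN 22; bookkeeping over GZK `hGZK` and
modularity `hmod`): a wild pair `(W, 3)` with `W[3]` irreducible, no rational `3`-torsion and a
congruent Kato unit anchor gets the UPPER half `ord₃ #Ш(W) ≤ ord₃ #Ш_an(W)`.  (The lower half on the
`3 ∤ #Ш_an` rows is free, `missingPPartAt_of_lower_of_upper`.)  Nothing asserted about `hX`.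
[cite: Miller2011LMS, §1 and Def. 1.1] [cite: Darmon2004, Thm. 3.22] -/
theorem X4WildRankZero.missingUpperBoundAt_of_congruentUnitAnchor (hX : X4UpperOfCongruentUnitAnchor)
    (hGZK : rank_eq_analyticRank_of_analyticRank_le_one) (hmod : hasEntireLFunction_rat)
    (W : WeierstrassCurve ℚ) [W.IsElliptic] [W.IsGloballyMinimal]
    (hO : ClassO6 W 3) (hirr : W.HasIrreducibleModPGaloisRep 3) (hr : W.analyticRank = 0)
    (ht : ¬ 3 ∣ W.torsionOrder)
    (hanchor : ∃ (W' : WeierstrassCurve ℚ) (_ : W'.IsElliptic) (_ : W'.IsGloballyMinimal),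
        ModPCongruent W' W 3 ∧ IsKatoUnitAnchor W' 3) :
    MissingUpperBoundAt W 3 := by
  have hL : W.entireLFunction 1 ≠ 0 := (W.analyticRank_eq_zero_iff_holds (hmod W)).mp hr
  obtain ⟨_, hfin⟩ := hGZK W (by rw [hr]; exact zero_le_one)
  obtain ⟨q₀, hq₀, hle⟩ :=
    hX W 3 hO.1 hO.2.1.1 hO.2.1.2 (ClassO6.padicValRat_j_nonneg hO) hirr hanchor hL hfin
  have ht0 : padicValNat 3 W.torsionOrder = 0 := padicValNat.eq_zero_of_not_dvd ht
  obtain ⟨q, hq, hle'⟩ := exists_shaAn_le_add_torsion_of_katoCurrency hGZK hmod W 3 hr hfin hq₀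
    (by rw [ht0, Nat.cast_zero, mul_zero, add_zero]; exact hle)
  refine ⟨q, hq, ?_⟩
  rw [ht0, Nat.cast_zero, add_zero] at hle'
  exact hle'

/-- … and the full `3`-part when moreover `3 ∤ #Ш_an(W)` (read as `ord₃ q = 0` for the rational
`q = #Ш_an(W)`): all `20` O6 ∧ r0 Elkies pairs have `3 ∤ #Ш_an(W)` (Cremona `allbsd`: `#Ш_an ∈ {1, 4, 25}`;
four of them — `388800ha1, ho1, ii1, ij1` — have `3 ∥ ∏ c_ℓ`, i.e. `ord₃(L/Ω) = 1`, the others `ord₃(L/Ω) = 0`) (memo §3).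
Bookkeeping. [cite: Miller2011LMS, §1 and Def. 1.1] -/
theorem X4WildRankZero.missingPPartAt_of_congruentUnitAnchor_of_unit (hX : X4UpperOfCongruentUnitAnchor)
    (hGZK : rank_eq_analyticRank_of_analyticRank_le_one) (hmod : hasEntireLFunction_rat)
    (W : WeierstrassCurve ℚ) [W.IsElliptic] [W.IsGloballyMinimal]
    (hO : ClassO6 W 3) (hirr : W.HasIrreducibleModPGaloisRep 3) (hr : W.analyticRank = 0)
    (ht : ¬ 3 ∣ W.torsionOrder)
    (hanchor : ∃ (W' : WeierstrassCurve ℚ) (_ : W'.IsElliptic) (_ : W'.IsGloballyMinimal),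
        ModPCongruent W' W 3 ∧ IsKatoUnitAnchor W' 3)
    {q : ℚ} (hq : shaAn W = (q : ℂ)) (hunit : padicValRat 3 q = 0) :
    MissingPPartAt W 3 := by
  have hu := X4WildRankZero.missingUpperBoundAt_of_congruentUnitAnchor hX hGZK hmod W hO hirr hr ht hanchor
  refine missingPPartAt_of_lower_of_upper W 3 ⟨q, hq, ?_⟩ hu
  rw [hunit]; exact_mod_cast Nat.zero_le _

/-- The anchor's big image makes `W[p]` irreducible for free: (12.5.2) for `W′` ⇒ `W′[p]`
irreducible (`Kato2004.hasIrreducibleModPGaloisRep_of_imageContainsSL2`) ⇒ transported along the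
congruence (`Mazur1978.hasIrreducibleModPGaloisRep_of_addEquiv`).  So the `hirr` binder of T-X4E is
implied by its anchor binder (kept in the display for readability). [folklore] -/
theorem hasIrreducibleModPGaloisRep_of_congruentAnchor {W : WeierstrassCurve ℚ} [W.IsElliptic]
    {p : ℕ} [Fact p.Prime]
    (h : ∃ (W' : WeierstrassCurve ℚ) (_ : W'.IsElliptic) (_ : W'.IsGloballyMinimal),
        ModPCongruent W' W p ∧ IsKatoUnitAnchor W' p) :
    W.HasIrreducibleModPGaloisRep p := by
  obtain ⟨W', hW'e, _, ⟨e, he⟩, _, _, _, himg, _⟩ := h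
  exact Mazur1978.hasIrreducibleModPGaloisRep_of_addEquiv e he
    (Kato2004.hasIrreducibleModPGaloisRep_of_imageContainsSL2 W' p himg)

/-- T-X4E in the cell's currency WITHOUT the irreducibility binder (it follows from the anchor).
Bookkeeping. [cite: Miller2011LMS, §1 and Def. 1.1] -/
theorem X4WildRankZero.missingUpperBoundAt_of_congruentUnitAnchor'
    (hX : X4UpperOfCongruentUnitAnchor)
    (hGZK : rank_eq_analyticRank_of_analyticRank_le_one) (hmod : hasEntireLFunction_rat)
    (W : WeierstrassCurve ℚ) [W.IsElliptic] [W.IsGloballyMinimal]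
    (hO : ClassO6 W 3) (hr : W.analyticRank = 0) (ht : ¬ 3 ∣ W.torsionOrder)
    (hanchor : ∃ (W' : WeierstrassCurve ℚ) (_ : W'.IsElliptic) (_ : W'.IsGloballyMinimal),
        ModPCongruent W' W 3 ∧ IsKatoUnitAnchor W' 3) :
    MissingUpperBoundAt W 3 :=
  X4WildRankZero.missingUpperBoundAt_of_congruentUnitAnchor hX hGZK hmod W hO
    (hasIrreducibleModPGaloisRep_of_congruentAnchor hanchor) hr ht hanchor

end X4E

end Summit.BirchSwinnertonDyer.Rank1Residual.O6

end
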